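import Summits.KontsevichZagierPeriods.KontsevichZagierPeriods.Theorems.UnfoldedStokesStokesGenerationFibrewiseRungPullback
import Literature.NumberTheory.Transcendental.SemialgebraicMapsProofs
import Mathlib.Analysis.Calculus.Deriv.Inv
import Mathlib.Analysis.Calculus.Deriv.Mul
import Mathlib.Analysis.Calculus.Deriv.Add

/-!
# `StokesGeneration` (stmt-KontsevichZagierPeriods-3586) — line `fibrewise_stokes`, stub `stub_anchorChartChange`

Registered stub B1 (RUNG A′ — from `π²` to Euler's `ζ(2)`: `Li₂(−1) = −π²/12` in the economy; wave 9, lead c6) of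
the line `fibrewise_stokes` of the crux `StokesGeneration` (route UnfoldedStokes; residual S2 `FibStokesDecomposable`,
`Theorems/UnfoldedStokesDefs.lean`): **the transition map between the two blow-up charts of `1/(1 − xy)` on the
sector `{x ≥ y}`.** With `w = z 0`, `y = z 1`, the integrand `P₁(w,y) = 1/(1 + yw)` is at the same time the
integrand of `−Li₂(−1) = π²/12` on the square and the corner blow-up `x = 1 − (1−y)w` of `1/(1 − xy)` on the sector
`{x ≥ y}`; squaring the variables first (`(x,y) = (X²,Y²)`) and blowing up afterwards gives instead
`P₂(w,y) = y(1 − (1−y)w)·k₁(w,y)`, `k₁(w,y) = 4/((1 + yw)(1 + y − y(1−y)w))` (the kernel of RUNG A). The two charts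
differ by the rational self-map `T(w,y) = (w(2 − (1−y)w)/(1+y), y²)` of the closed square: `T` is `C^∞` and
`ℚ`-semialgebraic on the box `(−1/8, 9/8)²` (where `1 + y > 0`), maps the square into itself
(`(1+y) − w(2 − (1−y)w) = (1−w)² + y(1−w)(1+w) ≥ 0`) and every closed face into itself (`w = 1 ↦ (1+y)/(1+y) = 1`),
and satisfies the pull-back identity `(P₁∘T)·det DT = P₂`: the Jacobian is triangular,
`det DT = ∂_w T₀ · ∂_y T₁ = 2(1 − (1−y)w)/(1+y) · 2y`, and `1 + y²·w(2 − (1−y)w)/(1+y) = (1 + yw)(1 + y − y(1−y)w)/(1+y)`.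
Hence rung 15 (`fibStokesDecomposable_sub_pullback`: Kontsevich–Zagier's rule (2) for face-preserving `C²` self-maps
of the closed cube, inside S2's economy) gives `P₁ − (P₁∘T)·det DT ∈ Dec`, which is the registered `P₁ − P₂ ∈ Dec`
point by point on the square (`fibStokesDecomposable_congr_off_null` with the empty null set). The entries of `DT`
are identified with one-variable derivatives along coordinate lines (`hasDerivAt_apply_update_of_hasFDerivAt`,
uniqueness of derivatives), and what is left is a rational identity in `(w, y)` (`field_simp; ring`).
Transcendence-free and value-free.

References: M. Kontsevich, D. Zagier, *Periods* (2001), §1.1 (the example `ζ(2)`), §1.2 rule (2); D. Zagier,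
*The dilogarithm function* (2007), §I.1 (`Li₂(−1) = −π²/12`); J. Bochnak, M. Coste, M.-F. Roy,
*Real Algebraic Geometry* (1998), Prop. 2.2.6.
-/

noncomputable section

-- `Summit.KontsevichZagierPeriods.KontsevichZagierPeriods.…` is the tree's mandated layout (single-conjunct summit).
set_option linter.dupNamespace false

namespace Summit.KontsevichZagierPeriods.KontsevichZagierPeriods.Cruxes.StokesGeneration.FibrewiseStokes

open MeasureTheory Set
open Literature.NumberTheory.Transcendental
open Literature.NumberTheory.Transcendental.KZ
open Literature.ModelTheory.ExponentialFields (IsSemialgebraic)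

/-- The open box `(−1/8, 9/8)²` around the closed square is `ℚ`-semialgebraic. [cite: BochnakCosteRoy1998, §2.1] -/
private theorem chartChange_isSemialgebraic_box :
    IsSemialgebraic ℚ {z : Fin 2 → ℝ | (-1 < 8 * z 0 ∧ 8 * z 0 < 9) ∧ (-1 < 8 * z 1 ∧ 8 * z 1 < 9)} := by
  have h : ∀ i : Fin 2, IsSemialgebraic ℚ {z : Fin 2 → ℝ | -1 < 8 * z i ∧ 8 * z i < 9} := fun i => by
    have h1 := Literature.ModelTheory.ExponentialFields.isSemialgebraic_setOf_eval_lt (k := ℚ) (R := ℝ)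
      (-1 : MvPolynomial (Fin 2) ℚ) (8 * MvPolynomial.X i)
    have h2 := Literature.ModelTheory.ExponentialFields.isSemialgebraic_setOf_eval_lt (k := ℚ) (R := ℝ)
      (8 * MvPolynomial.X i : MvPolynomial (Fin 2) ℚ) 9
    simp only [map_neg, map_one, map_mul, MvPolynomial.aeval_X, map_ofNat] at h1 h2
    simpa only [Set.setOf_and] using h1.inter h2
  simpa only [Set.setOf_and] using (h 0).inter (h 1)

/-- **The Jacobian identity, algebraic core.** For the transition map `T(w,y) = (w(2 − (1−y)w)/(1+y), y²)`: if
`J₀₀` is the derivative of `T₀` along `w`, `J₁₀ = 0` that of `T₁` along `w` and `J₁₁ = 2y` that of `T₁` along `y`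
(each characterised by uniqueness of one-variable derivatives; `J₀₁` is arbitrary, the Jacobian being triangular),
then `P₁(T(w,y))·(J₀₀J₁₁ − J₀₁J₁₀) = y(1 − (1−y)w)·k₁(w,y)`, because
`1 + y²·w(2 − (1−y)w)/(1+y) = (1 + yw)(1 + y − y(1−y)w)/(1+y)`. [cite: KontsevichZagier2001, §1.2 rule (2)] -/
private theorem chartChange_core (w y J00 J01 J10 J11 : ℝ) (hy : 0 < 1 + y) (hk1 : 0 < 1 + y * w)
    (hk2 : 0 < 1 + y - y * (1 - y) * w)
    (H00 : ∀ A : ℝ, HasDerivAt (fun t : ℝ => t * (2 - (1 - y) * t) / (1 + y)) A w → J00 = A)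
    (H10 : ∀ D : ℝ, HasDerivAt (fun _ : ℝ => y * y) D w → J10 = D)
    (H11 : ∀ D : ℝ, HasDerivAt (fun t : ℝ => t * t) D y → J11 = D) :
    1 / (1 + y * y * (w * (2 - (1 - y) * w) / (1 + y))) * (J00 * J11 - J01 * J10) =
      y * (1 - (1 - y) * w) * (4 / ((1 + y * w) * (1 + y - y * (1 - y) * w))) := by
  have e00 := H00 _ (((hasDerivAt_id' w).fun_mul
    (((hasDerivAt_id' w).const_mul (1 - y)).const_sub 2)).div_const (1 + y))
  have e10 := H10 _ (hasDerivAt_const w (y * y))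
  have e11 := H11 _ ((hasDerivAt_id' y).fun_mul (hasDerivAt_id' y))
  rw [e00, e10, e11]
  have hyne := hy.ne'
  have hk1ne := hk1.ne'
  have hk2ne := hk2.ne'
  have hD : 1 + y * y * (w * (2 - (1 - y) * w) / (1 + y)) =
      (1 + y * w) * (1 + y - y * (1 - y) * w) / (1 + y) := by
    rw [eq_div_iff hyne]
    field_simp
    ring
  rw [hD]
  field_simp
  ring

/-- **Registered stub `stub_anchorChartChange` (RUNG A′, B1): the transition map between the two blow-up charts of
`1/(1 − xy)` on the sector `{x ≥ y}`.** With `w = z 0`, `y = z 1`, `P₁ = 1/(1 + yw)` (the integrand of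
`−Li₂(−1) = π²/12`, equivalently the corner blow-up of `1/(1 − xy)` on `{x ≥ y}`) and
`P₂ = y(1 − (1−y)w)·4/((1 + yw)(1 + y − y(1−y)w))` (blow-up after squaring the variables), the relator `P₁ − P₂` is
fibrewise-Stokes decomposable: it is Kontsevich–Zagier's rule (2) (rung 15, `fibStokesDecomposable_sub_pullback`)
for the face-preserving rational self-map `T(w,y) = (w(2 − (1−y)w)/(1+y), y²)` of the closed square, whose pull-back
identity is `(P₁∘T)·det DT = P₂` (`det DT = 4y(1 − (1−y)w)/(1+y)`). [cite: KontsevichZagier2001, §1.2 rule (2)] -/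
theorem stub_anchorChartChange :
    FibStokesDecomposable 2 (fun z => 1 / (1 + z 1 * z 0) -
      z 1 * (1 - (1 - z 1) * z 0) * (4 / ((1 + z 1 * z 0) * (1 + z 1 - z 1 * (1 - z 1) * z 0)))) := by
  set U : Set (Fin 2 → ℝ) := {z | (-1 < 8 * z 0 ∧ 8 * z 0 < 9) ∧ (-1 < 8 * z 1 ∧ 8 * z 1 < 9)} with hU
  have hUsa : IsSemialgebraic ℚ U := chartChange_isSemialgebraic_box
  have hUo : IsOpen U := by
    rw [hU]
    simp only [Set.setOf_and]
    exact ((isOpen_lt continuous_const (continuous_const.mul (continuous_apply 0))).inter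
      (isOpen_lt (continuous_const.mul (continuous_apply 0)) continuous_const)).inter
      ((isOpen_lt continuous_const (continuous_const.mul (continuous_apply 1))).inter
      (isOpen_lt (continuous_const.mul (continuous_apply 1)) continuous_const))
  have hCU : Set.pi Set.univ (fun _ : Fin 2 => Set.Icc (0:ℝ) 1) ⊆ U := fun z hz => by
    have h0 := hz 0 (Set.mem_univ _)
    have h1 := hz 1 (Set.mem_univ _)
    exact ⟨⟨by linarith [h0.1], by linarith [h0.2]⟩, ⟨by linarith [h1.1], by linarith [h1.2]⟩⟩
  -- the two denominators are positive on `U`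
  have hyU : ∀ z ∈ U, (0:ℝ) < 1 + z 1 := fun z hz => by linarith [hz.2.1]
  have hkU : ∀ z ∈ U, (0:ℝ) < 1 + z 1 * z 0 := fun z hz => by
    nlinarith [mul_pos (show (0:ℝ) < 8 * z 0 + 1 by linarith [hz.1.1])
      (show (0:ℝ) < 8 * z 1 + 1 by linarith [hz.2.1]), hz.1.2, hz.2.2]
  -- the map `T` and the integrand `h = P₁`
  obtain ⟨T, hT⟩ : ∃ T : (Fin 2 → ℝ) → (Fin 2 → ℝ), T = fun z =>
      ![z 0 * (2 - (1 - z 1) * z 0) / (1 + z 1), z 1 * z 1] := ⟨_, rfl⟩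
  have hT0 : ∀ z, T z 0 = z 0 * (2 - (1 - z 1) * z 0) / (1 + z 1) := fun z => by simp [hT]
  have hT1 : ∀ z, T z 1 = z 1 * z 1 := fun z => by simp [hT]
  obtain ⟨h, hh⟩ : ∃ h : (Fin 2 → ℝ) → ℝ, h = fun z => 1 / (1 + z 1 * z 0) := ⟨_, rfl⟩
  -- semialgebraicity
  have hz0 : IsSemialgebraicFunOn ℚ U (fun z => z 0) := isSemialgebraicFunOn_apply hUsa 0
  have hz1 : IsSemialgebraicFunOn ℚ U (fun z => z 1) := isSemialgebraicFunOn_apply hUsa 1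
  have h1 : IsSemialgebraicFunOn ℚ U (fun _ => (1:ℝ)) := by simpa using isSemialgebraicFunOn_const_natCast hUsa 1
  have hTsa : IsSemialgebraicMapOn ℚ U T :=
    IsSemialgebraicMapOn.of_forall hUsa (Fin.forall_fin_two.2
      ⟨((hz0.fun_mul ((isSemialgebraicFunOn_const_ofNat hUsa 2).fun_sub ((h1.fun_sub hz1).fun_mul hz0))).div
          (h1.fun_add hz1) fun z hz => (hyU z hz).ne').congr fun z _ => (hT0 z).symm,
        (hz1.fun_mul hz1).congr fun z _ => (hT1 z).symm⟩)
  have hhsa : IsSemialgebraicFunOn ℚ U h := by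
    rw [hh]
    exact h1.div (h1.fun_add (hz1.fun_mul hz0)) fun z hz => (hkU z hz).ne'
  -- regularity
  have hc0 := contDiffOn_apply (n := 2) ℝ ℝ (0 : Fin 2) U
  have hc1 := contDiffOn_apply (n := 2) ℝ ℝ (1 : Fin 2) U
  have hTc : ContDiffOn ℝ 2 T U :=
    contDiffOn_pi' (Fin.forall_fin_two.2
      ⟨((hc0.mul (contDiffOn_const.sub ((contDiffOn_const.sub hc1).mul hc0))).fun_div
          (contDiffOn_const.add hc1) fun z hz => (hyU z hz).ne').congr fun z _ => hT0 z,
        (hc1.mul hc1).congr fun z _ => hT1 z⟩)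
  have hhc : ContDiffOn ℝ 1 h U := by
    rw [hh]
    have hc0' := contDiffOn_apply (n := 1) ℝ ℝ (0 : Fin 2) U
    have hc1' := contDiffOn_apply (n := 1) ℝ ℝ (1 : Fin 2) U
    exact contDiffOn_const.fun_div (contDiffOn_const.add (hc1'.mul hc0')) fun z hz => (hkU z hz).ne'
  -- the closed square is mapped into itself, faces into faces
  have hsq : ∀ z ∈ Set.pi Set.univ (fun _ : Fin 2 => Set.Icc (0:ℝ) 1),
      (0 ≤ T z 0 ∧ T z 0 ≤ 1) ∧ (0 ≤ T z 1 ∧ T z 1 ≤ 1) := by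
    intro z hz
    obtain ⟨hw0, hw1⟩ := hz 0 (Set.mem_univ _)
    obtain ⟨hy0, hy1⟩ := hz 1 (Set.mem_univ _)
    have hy : (0:ℝ) < 1 + z 1 := by linarith
    rw [hT0, hT1]
    refine ⟨⟨div_nonneg (mul_nonneg hw0 (by nlinarith [mul_nonneg hy0 hw0])) hy.le, (div_le_one hy).2 ?_⟩,
      mul_nonneg hy0 hy0, mul_le_one₀ hy1 hy0 hy1⟩
    nlinarith [sq_nonneg (1 - z 0), mul_nonneg hy0 (sub_nonneg.2 hw1),
      mul_nonneg (mul_nonneg hy0 (sub_nonneg.2 hw1)) hw0]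
  have hmaps : Set.MapsTo T (Set.pi Set.univ (fun _ : Fin 2 => Set.Icc (0:ℝ) 1))
      (Set.pi Set.univ (fun _ : Fin 2 => Set.Icc (0:ℝ) 1)) := fun z hz =>
    Set.mem_univ_pi.2 (Fin.forall_fin_two.2 ⟨⟨(hsq z hz).1.1, (hsq z hz).1.2⟩, ⟨(hsq z hz).2.1, (hsq z hz).2.2⟩⟩)
  have hface : ∀ z ∈ Set.pi Set.univ (fun _ : Fin 2 => Set.Icc (0:ℝ) 1), ∀ j : Fin 2,
      (z j = 0 → T z j = 0) ∧ (z j = 1 → T z j = 1) := by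
    intro z hz
    obtain ⟨hy0, -⟩ := hz 1 (Set.mem_univ _)
    have hy : (1 + z 1 : ℝ) ≠ 0 := by linarith
    refine Fin.forall_fin_two.2 ⟨⟨fun e0 => by rw [hT0, e0]; simp, fun e1 => ?_⟩,
      ⟨fun e0 => by rw [hT1, e0, mul_zero], fun e1 => by rw [hT1, e1, mul_one]⟩⟩
    rw [hT0, e1, div_eq_one_iff_eq hy]
    ring
  -- rung 15, and the Jacobian identity at every point of the closed square
  refine fibStokesDecomposable_congr_off_null 2 _ _ ∅ Literature.ModelTheory.ExponentialFields.isSemialgebraic_empty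
    measure_empty (fun z hz _ => ?_) (fibStokesDecomposable_sub_pullback U hUo hCU T h hTsa hhsa hTc hhc hmaps hface)
  have hzU := hCU hz
  obtain ⟨hw0, hw1⟩ := hz 0 (Set.mem_univ _)
  obtain ⟨hy0, hy1⟩ := hz 1 (Set.mem_univ _)
  have hy : (0:ℝ) < 1 + z 1 := by linarith
  have hk1 : (0:ℝ) < 1 + z 1 * z 0 := add_pos_of_pos_of_nonneg one_pos (mul_nonneg hy0 hw0)
  have hk2 : (0:ℝ) < 1 + z 1 - z 1 * (1 - z 1) * z 0 := by
    nlinarith [mul_nonneg (mul_nonneg hy0 (sub_nonneg.2 hy1)) (sub_nonneg.2 hw1), sq_nonneg (z 1)]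
  have hL := ((hTc.differentiableOn (by norm_num)).differentiableAt (hUo.mem_nhds hzU)).hasFDerivAt
  have hline := fun j k => hasDerivAt_apply_update_of_hasFDerivAt hL j k
  have hu1 : ∀ s : ℝ, Function.update z 0 s 1 = z 1 := fun s => Function.update_of_ne (by decide) s z
  have h00 := hline 0 0
  have h10 := hline 0 1
  have h11 := hline 1 1
  simp only [hT0, hT1, Function.update_self, hu1] at h00 h10 h11
  rw [hh]
  beta_reduce
  have hdet : (fderiv ℝ T z).det = (Literature.Analysis.Calculus.jacobianMatrix T z).det :=
    (Literature.Analysis.Calculus.det_jacobianMatrix T z).symm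
  rw [hdet, Matrix.det_fin_two]
  simp only [Literature.Analysis.Calculus.jacobianMatrix_apply, hT0, hT1]
  rw [sub_right_inj]
  exact chartChange_core (z 0) (z 1) _ _ _ _ hy hk1 hk2 (fun A hA => h00.unique hA) (fun D hD => h10.unique hD)
    (fun D hD => h11.unique hD)

end Summit.KontsevichZagierPeriods.KontsevichZagierPeriods.Cruxes.StokesGeneration.FibrewiseStokes

end
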